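import Summits.Parity.GeneralizedHardyLittlewood.Theorems.LeeYangFibresRelativeDimOneTypeDataA
import HarnessLib

/-!
# Type data for the reshaped line `gallagher-backwards-split` (crux stmt-Parity-14113
`LeeYangFibres.RelativeDimOne`, stub `stub_typeData`), PART D: the Chinese remainder theorem on type cells

For a squarefree modulus `q`, the cell modulus `P = ∏_{p ≤ w} p` (squarefree), `q₁ = gcd(q, P)`, `q₂ = q/q₁`,
`P' = P/q₁`, and a `q`-periodic function `h` of the shift vector: the sum of `h` over the residue vectors
`r ∈ [0, P q₂)^t` of the type cell of the target `b₀` (types prescribed at the primes of `P`) is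
`#typeCell P P a b₀ · q₂^t · condAvg q w a b₀ h` (`cell_residue_sum`, registered hook `typeData_cellResidueSum`).
Mechanism: `[0, mn)^t ≅ [0,m)^t × [0,n)^t` for coprime `m, n` (`sum_piFinset_mul_of_coprime`, by
`Nat.chineseRemainder`); the cell condition modulo `P = q₁ P'` splits into the conditions modulo `q₁` and `P'`,
the `w`-conditioned type cell modulo `q = q₁ q₂` is the cell modulo `q₁` times `[0, q₂)^t`, and `P q₂ = P' q`.
-/

noncomputable section

open scoped BigOperators Classical
open Finset Literature.NumberTheory.Sieve
open Summit.Parity.GeneralizedHardyLittlewood.Cruxes.RelativeDimOne.GallagherBackwardsSplit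

namespace Summit.Parity.GeneralizedHardyLittlewood.Cruxes.RelativeDimOne.TypeSplit

namespace TypeDataProof

variable {t : ℕ}

/-! ### The Chinese remainder theorem for residue vectors -/

/-- CRT, product form: for coprime `m, n > 0`,
`Σ_{r ∈ [0, mn)^t} F(r mod m) G(r mod n) = (Σ_{x ∈ [0,m)^t} F x)(Σ_{y ∈ [0,n)^t} G y)`. -/
theorem sum_piFinset_mul_of_coprime {m n : ℕ} (hm : 0 < m) (hn : 0 < n) (hcop : Nat.Coprime m n)
    (F G : (Fin t → ℕ) → ℝ) :
    ∑ r ∈ Fintype.piFinset (fun _ : Fin t => range (m * n)),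
        F (Gallagher.modVec m r) * G (Gallagher.modVec n r) =
      (∑ x ∈ Fintype.piFinset (fun _ : Fin t => range m), F x) *
        ∑ y ∈ Fintype.piFinset (fun _ : Fin t => range n), G y := by
  rw [Finset.sum_mul_sum, ← Finset.sum_product']
  refine Finset.sum_nbij' (fun r => (Gallagher.modVec m r, Gallagher.modVec n r))
    (fun xy => fun k => (Nat.chineseRemainder hcop (xy.1 k) (xy.2 k) : ℕ)) ?_ ?_ ?_ ?_ ?_
  · intro r _
    simp only [mem_product, Fintype.mem_piFinset, mem_range, Gallagher.modVec_apply]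
    exact ⟨fun k => Nat.mod_lt _ hm, fun k => Nat.mod_lt _ hn⟩
  · intro xy _
    simp only [Fintype.mem_piFinset, mem_range]
    intro k
    exact Nat.chineseRemainder_lt_mul hcop _ _ hm.ne' hn.ne'
  · intro r hr
    simp only [Fintype.mem_piFinset, mem_range] at hr
    funext k
    have h1 := Nat.chineseRemainder_modEq_unique hcop (z := r k)
      (Nat.mod_modEq (r k) m).symm (Nat.mod_modEq (r k) n).symm
    exact (Nat.ModEq.eq_of_lt_of_lt h1.symm (Nat.chineseRemainder_lt_mul hcop _ _ hm.ne' hn.ne') (hr k))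
  · intro xy hxy
    simp only [mem_product, Fintype.mem_piFinset, mem_range] at hxy
    refine Prod.ext ?_ ?_
    · funext k
      show (Nat.chineseRemainder hcop (xy.1 k) (xy.2 k) : ℕ) % m = xy.1 k
      have h1 := (Nat.chineseRemainder hcop (xy.1 k) (xy.2 k)).2.1
      unfold Nat.ModEq at h1
      rw [h1, Nat.mod_eq_of_lt (hxy.1 k)]
    · funext k
      show (Nat.chineseRemainder hcop (xy.1 k) (xy.2 k) : ℕ) % n = xy.2 k
      have h1 := (Nat.chineseRemainder hcop (xy.1 k) (xy.2 k)).2.2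
      unfold Nat.ModEq at h1
      rw [h1, Nat.mod_eq_of_lt (hxy.2 k)]
  · intro r _
    rfl

/-- Splitting an indicator-weighted value along `C ↔ A ∧ B`. -/
theorem ite_split {C A B : Prop} [Decidable C] [Decidable A] [Decidable B] (hC : C ↔ A ∧ B) (c : ℝ) :
    (if C then c else 0) = (if A then (1 : ℝ) else 0) * (if B then c else 0) := by
  by_cases hA : A <;> by_cases hB : B
  · rw [if_pos (hC.2 ⟨hA, hB⟩), if_pos hA, if_pos hB, one_mul]
  · rw [if_neg (fun h => hB (hC.1 h).2), if_pos hA, if_neg hB, mul_zero]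
  · rw [if_neg (fun h => hA (hC.1 h).1), if_neg hA, zero_mul]
  · rw [if_neg (fun h => hA (hC.1 h).1), if_neg hA, zero_mul]

/-- `typeCell P P a b₀` is the set of residue vectors in `[0, P)^t` of the cell (filter form). -/
theorem typeCell_self_eq_filter (P : ℕ) (a b₀ : Fin t → ℤ) :
    typeCell P P a b₀ = (Fintype.piFinset fun _ : Fin t => range P).filter
      (fun v => ∀ p ∈ P.primeFactors, incType p a (fun i => (v i : ℤ)) = incType p a b₀) := by
  ext v
  rw [mem_filter, mem_typeCell_self_iff]

/-! ### Arithmetic of the smooth and rough parts of a squarefree modulus -/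

/-- For squarefree `q` and `P = ∏_{p ≤ w} p`, `q₁ = gcd(q, P)`, `q₂ = q / q₁`: `1 ≤ q₂ ≤ q` and `q ∣ P q₂`. -/
theorem rough_part_facts (w : ℕ) {q : ℕ} (hq : 1 ≤ q) (hsq : Squarefree q) :
    1 ≤ q / Nat.gcd q (primorial w) ∧ q / Nat.gcd q (primorial w) ≤ q ∧
      q ∣ primorial w * (q / Nat.gcd q (primorial w)) := by
  have hq₁q : Nat.gcd q (primorial w) ∣ q := Nat.gcd_dvd_left q _
  have hq₁P : Nat.gcd q (primorial w) ∣ primorial w := Nat.gcd_dvd_right q _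
  have hq₁0 : 0 < Nat.gcd q (primorial w) := Nat.gcd_pos_of_pos_left _ hq
  have hqq : q = Nat.gcd q (primorial w) * (q / Nat.gcd q (primorial w)) := by
    rw [mul_comm, Nat.div_mul_cancel hq₁q]
  refine ⟨Nat.div_pos (Nat.le_of_dvd hq hq₁q) hq₁0, Nat.div_le_self _ _, ?_⟩
  obtain ⟨P', hP'⟩ := hq₁P
  have _ := hsq
  calc q = Nat.gcd q (primorial w) * (q / Nat.gcd q (primorial w)) := hqq
    _ ∣ (Nat.gcd q (primorial w) * P') * (q / Nat.gcd q (primorial w)) :=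
        Nat.mul_dvd_mul_right (Dvd.intro P' rfl) _
    _ = primorial w * (q / Nat.gcd q (primorial w)) := by rw [← hP']

/-! ### The residue sum over the cell -/

/-- CRT ON TYPE CELLS: for a squarefree `q`, `P = ∏_{p ≤ w} p`, `q₂ = q / gcd(q, P)` and a `q`-periodic `h`, the sum
of `h` over the residue vectors `r ∈ [0, P q₂)^t` of the type cell of `b₀` (types prescribed at the primes of `P`)
equals `#typeCell P P a b₀ · q₂^t · condAvg q w a b₀ h`. -/
theorem cell_residue_sum (w : ℕ) {q : ℕ} (hq : 1 ≤ q) (hsq : Squarefree q) (a b₀ : Fin t → ℤ)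
    (h : (Fin t → ℤ) → ℝ) (hh : ∀ b b' : Fin t → ℤ, (∀ i, b i ≡ b' i [ZMOD q]) → h b = h b') :
    ∑ v ∈ (Fintype.piFinset fun _ : Fin t => range (primorial w * (q / Nat.gcd q (primorial w)))).filter
        (fun v => ∀ p ∈ (primorial w).primeFactors, incType p a (fun i => (v i : ℤ)) = incType p a b₀),
        h (fun i => (v i : ℤ)) =
      ((typeCell (primorial w) (primorial w) a b₀).card : ℝ) *
        ((q / Nat.gcd q (primorial w) : ℕ) : ℝ) ^ t * condAvg q w a b₀ h := by
  -- the four moduli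
  set P := primorial w with hP
  have hP0 : 0 < P := primorial_pos w
  have hPsq : Squarefree P := squarefree_primorial w
  set q₁ := Nat.gcd q P with hq₁
  have hq₁q : q₁ ∣ q := Nat.gcd_dvd_left q P
  have hq₁P : q₁ ∣ P := Nat.gcd_dvd_right q P
  have hq₁0 : 0 < q₁ := Nat.gcd_pos_of_pos_left P hq
  set q₂ := q / q₁ with hq₂
  set P' := P / q₁ with hP'
  have hqq : q = q₁ * q₂ := by rw [hq₂, mul_comm, Nat.div_mul_cancel hq₁q]
  have hPP : P = q₁ * P' := by rw [hP', mul_comm, Nat.div_mul_cancel hq₁P]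
  have hq0 : 0 < q := hq
  have hq₂0 : 0 < q₂ := Nat.div_pos (Nat.le_of_dvd hq hq₁q) hq₁0
  have hP'0 : 0 < P' := Nat.div_pos (Nat.le_of_dvd hP0 hq₁P) hq₁0
  have hcop12 : Nat.Coprime q₁ q₂ := Nat.coprime_of_squarefree_mul (hqq ▸ hsq)
  have hcop1P' : Nat.Coprime q₁ P' := Nat.coprime_of_squarefree_mul (hPP ▸ hPsq)
  have hcopq₂P : Nat.Coprime q₂ P := by
    have hg1 : Nat.gcd q₂ P ∣ q₁ :=
      Nat.dvd_gcd ((Nat.gcd_dvd_left _ _).trans (Dvd.intro_left q₁ hqq.symm)) (Nat.gcd_dvd_right _ _)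
    have hg2 : Nat.gcd q₂ P ∣ q₂ := Nat.gcd_dvd_left _ _
    exact Nat.Coprime.eq_one_of_dvd (Nat.Coprime.coprime_dvd_left hg2 hcop12.symm) hg1
  have hcopP'q : Nat.Coprime P' q := by
    rw [hqq]
    exact Nat.Coprime.mul_right hcop1P'.symm
      (Nat.Coprime.coprime_dvd_left (Nat.div_dvd_of_dvd hq₁P) hcopq₂P.symm)
  have hM : P * q₂ = P' * q := by rw [hPP, hqq]; ring
  -- prime factors
  have hsplitP : ∀ v : Fin t → ℤ,
      (∀ p ∈ P.primeFactors, incType p a v = incType p a b₀) ↔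
        (∀ p ∈ q₁.primeFactors, incType p a v = incType p a b₀) ∧
          (∀ p ∈ P'.primeFactors, incType p a v = incType p a b₀) := by
    intro v
    rw [hPP, Nat.primeFactors_mul hq₁0.ne' hP'0.ne', Finset.forall_mem_union]
  have hcellq : typeCell q w a b₀ = (Fintype.piFinset fun _ : Fin t => range q).filter
      (fun v => ∀ p ∈ q₁.primeFactors, incType p a (fun i => (v i : ℤ)) = incType p a b₀) := by
    unfold typeCell
    refine Finset.filter_congr fun v _ => ⟨fun H p hp => ?_, fun H p hp hpw => ?_⟩
    · have hp' := Nat.mem_primeFactors.1 hp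
      exact H p (Nat.mem_primeFactors.2 ⟨hp'.1, hp'.2.1.trans hq₁q, hq0.ne'⟩)
        ((Nat.Prime.dvd_primorial_iff hp'.1).1 (hp'.2.1.trans hq₁P))
    · have hp' := Nat.mem_primeFactors.1 hp
      exact H p (Nat.mem_primeFactors.2
        ⟨hp'.1, Nat.dvd_gcd hp'.2.1 ((Nat.Prime.dvd_primorial_iff hp'.1).2 hpw), hq₁0.ne'⟩)
  -- residue congruences
  have hmodq : ∀ (r : Fin t → ℕ) (n : ℕ), ∀ i, ((r i : ℕ) : ℤ) ≡ ((Gallagher.modVec n r i : ℕ) : ℤ) [ZMOD n] :=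
    fun r n i => by
      rw [Gallagher.modVec_apply, Int.natCast_mod]
      exact (Int.mod_modEq _ _).symm
  -- the indicator functions
  set I₁ : (Fin t → ℕ) → ℝ := fun x =>
    if (∀ p ∈ q₁.primeFactors, incType p a (fun i => (x i : ℤ)) = incType p a b₀) then 1 else 0 with hI₁
  set F' : (Fin t → ℕ) → ℝ := fun x =>
    if (∀ p ∈ P'.primeFactors, incType p a (fun i => (x i : ℤ)) = incType p a b₀) then 1 else 0 with hF'
  set G : (Fin t → ℕ) → ℝ := fun v =>
    if (∀ p ∈ q₁.primeFactors, incType p a (fun i => (v i : ℤ)) = incType p a b₀) then h (fun i => (v i : ℤ))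
      else 0 with hG
  set K₁ : ℝ := ∑ x ∈ Fintype.piFinset (fun _ : Fin t => range q₁), I₁ x with hK₁
  set K' : ℝ := ∑ x ∈ Fintype.piFinset (fun _ : Fin t => range P'), F' x with hK'
  -- (D2) `#typeCell P P a b₀ = K₁ K'`
  have hK : ((typeCell P P a b₀).card : ℝ) = K₁ * K' := by
    rw [typeCell_self_eq_filter, Finset.card_eq_sum_ones, Nat.cast_sum, Finset.sum_filter, hPP,
      ← sum_piFinset_mul_of_coprime hq₁0 hP'0 hcop1P' I₁ F']
    push_cast
    refine Finset.sum_congr rfl fun x _ => ?_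
    have e1 := isCell_congr (P := q₁) a b₀ (fun i => (hmodq x q₁ i))
    have e2 := isCell_congr (P := P') a b₀ (fun i => (hmodq x P' i))
    rw [← hPP]
    have hC := (hsplitP (fun i => ((x i : ℕ) : ℤ))).trans (and_congr e1 e2)
    convert ite_split hC (1 : ℝ) using 1
  -- (D5) `#typeCell q w a b₀ = K₁ q₂^t`
  have hKq : ((typeCell q w a b₀).card : ℝ) = K₁ * (q₂ : ℝ) ^ t := by
    rw [hcellq, Finset.card_eq_sum_ones, Nat.cast_sum, Finset.sum_filter, hqq]
    have e0 : (q₂ : ℝ) ^ t = ∑ _y ∈ Fintype.piFinset (fun _ : Fin t => range q₂), (1 : ℝ) := by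
      rw [Finset.sum_const, Fintype.card_piFinset, Finset.prod_const, Finset.card_range, Finset.card_univ,
        Fintype.card_fin, nsmul_eq_mul, mul_one]
      push_cast
      rfl
    rw [e0, ← sum_piFinset_mul_of_coprime hq₁0 hq₂0 hcop12 I₁ (fun _ => (1 : ℝ))]
    push_cast
    refine Finset.sum_congr rfl fun x _ => ?_
    have e1 := isCell_congr (P := q₁) a b₀ (fun i => (hmodq x q₁ i))
    rw [mul_one]
    simp only [hI₁]
    by_cases h1 : ∀ p ∈ q₁.primeFactors, incType p a (fun i => ((x i : ℕ) : ℤ)) = incType p a b₀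
    · rw [if_pos h1, if_pos (e1.1 h1)]
    · rw [if_neg h1, if_neg (fun H => h1 (e1.2 H))]
  -- (D6) `K₁ > 0`
  have hK₁pos : 0 < K₁ := by
    have h0 : K₁ = ((typeCell q₁ q₁ a b₀).card : ℝ) := by
      rw [typeCell_self_eq_filter, Finset.card_eq_sum_ones, Nat.cast_sum, Finset.sum_filter]
      push_cast
      rfl
    rw [h0]
    exact_mod_cast typeCell_self_card_pos hq₁0 a b₀
  -- (D3) the residue sum
  have hmain : ∑ v ∈ (Fintype.piFinset fun _ : Fin t => range (P * q₂)).filter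
        (fun v => ∀ p ∈ P.primeFactors, incType p a (fun i => (v i : ℤ)) = incType p a b₀),
        h (fun i => (v i : ℤ)) = K' * ∑ v ∈ typeCell q w a b₀, h (fun i => (v i : ℤ)) := by
    rw [Finset.sum_filter, hM, hcellq, Finset.sum_filter,
      ← sum_piFinset_mul_of_coprime hP'0 hq0 hcopP'q F' G]
    refine Finset.sum_congr rfl fun r _ => ?_
    have eP' := isCell_congr (P := P') a b₀ (fun i => (hmodq r P' i))
    have eq₁ := isCell_congr (P := q₁) a b₀
      (fun i => ((hmodq r q i).of_dvd (Int.natCast_dvd_natCast.2 hq₁q)))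
    have ehh := hh _ _ (fun i => (hmodq r q i))
    have hC : (∀ p ∈ P.primeFactors, incType p a (fun i => ((r i : ℕ) : ℤ)) = incType p a b₀) ↔
        (∀ p ∈ P'.primeFactors,
            incType p a (fun i => ((Gallagher.modVec P' r i : ℕ) : ℤ)) = incType p a b₀) ∧
          (∀ p ∈ q₁.primeFactors,
            incType p a (fun i => ((Gallagher.modVec q r i : ℕ) : ℤ)) = incType p a b₀) :=
      (hsplitP _).trans ((and_congr eq₁ eP').trans and_comm)
    rw [ehh]
    convert ite_split hC (h (fun i => ((Gallagher.modVec q r i : ℕ) : ℤ))) using 1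
  -- assembly
  rw [hmain, hK]
  unfold condAvg
  rw [hKq]
  have hne : K₁ * (q₂ : ℝ) ^ t ≠ 0 := by positivity
  field_simp

/-- Registered hook (aux for `stub_typeData`): the Chinese remainder theorem on type cells. -/
theorem typeData_cellResidueSum : ∀ {t : ℕ} (w : ℕ) {q : ℕ}, 1 ≤ q → Squarefree q → ∀ (a b₀ : Fin t → ℤ) (h : (Fin t → ℤ) → ℝ), (∀ b b' : Fin t → ℤ, (∀ i, b i ≡ b' i [ZMOD q]) → h b = h b') → ∑ v ∈ (Fintype.piFinset fun _ : Fin t => Finset.range (primorial w * (q / Nat.gcd q (primorial w)))).filter (fun v => ∀ p ∈ (primorial w).primeFactors, incType p a (fun i => (v i : ℤ)) = incType p a b₀), h (fun i => (v i : ℤ)) = ((typeCell (primorial w) (primorial w) a b₀).card : ℝ) * ((q / Nat.gcd q (primorial w) : ℕ) : ℝ) ^ t * condAvg q w a b₀ h :=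
  fun w _ hq hsq a b₀ h hh => cell_residue_sum w hq hsq a b₀ h hh

end TypeDataProof

end Summit.Parity.GeneralizedHardyLittlewood.Cruxes.RelativeDimOne.TypeSplit

end
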